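import Mathlib
import HarnessLib

/-!
# Format C: the Schur step with a DIAGONAL far bound (complete the square mode by mode)

Route context as in `Summits/RiemannHypothesis/RiemannHypothesis/Theorems/WeilFormatCSchurStep.lean` (weil-3): the
Fourier–Galerkin certificates of Weil positivity on a window (cell memo
`run/shared/lean/pub/rh-explicit/rh-explicit-weil-10/FORMATC-DESIGN.md`, §1 (c3) and §4.10; supporting
stmt-RiemannHypothesis-0098).  That file handles a SCALAR complement-coercivity constant `μ_N` (the far block is
`⪰ μ_N·1`).  The certificates actually produced from a = 18/25 upward (EXTREMALS `t-1825-C`, `t-4023-5000-C`,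
`t-09-C`) use instead the DIAGONAL far bound of FORMATC-DESIGN §4.10: on the far modes `m > M₁` the sector Gram is
`⪰ diag(d_m)` with an explicit, GROWING `d_m = Re ψ(¼ + iω_m/2) − C [− h(m)]`, and the coupling is absorbed mode by
mode: `2 c_m y_m + d_m y_m² ≥ −c_m²/d_m`.  The kernel step then decides `G − U ⪰ 0` for any majorant
`U ⪰ Σ_m c_m c_mᵀ/d_m` (`c_m = (W(n,m))_{n ≤ M₁}` the m-th coupling column).

This file is the algebra of that step, over `ℝ`, with the analytic quantities as parameters — no function
spaces, no Weil-specific objects: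

* `WeilFormatC.two_mul_add_mul_sq_ge` — one mode: `−c²/e ≤ 2 c y + e y²` for `e > 0`;
* `WeilFormatC.schurStepDiag` — **margin form**: if `μ⋆ < d m` for every far mode, `Σ_m c_m²/(d_m − μ⋆) ≤ xᵀUx`
  and `μ⋆ xᵀx + xᵀUx ≤ xᵀGx` (the certified matrix inequality `G − μ⋆·1 − U ⪰ 0`), then
  `μ⋆ (xᵀx + Σ y_m²) ≤ xᵀGx + 2 Σ_m c_m y_m + Σ_m d_m y_m²`;
* `WeilFormatC.schurStepDiag_nonneg` — the `μ⋆ = 0` form (plain positivity), and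
  `WeilFormatC.schurStepDiag_nonneg_of_farBound` — the same with the far self-energy `D` and the hypothesis
  `Σ d_m y_m² ≤ D` in place of the diagonal sum (how the far-coercivity lemma L-C3a is consumed);
* `WeilFormatC.schurStepDiag_posSemidef` — the kernel hypothesis delivered as `(G − U).PosSemidef`.

The far index set `κ` is an arbitrary `Fintype` (a finite truncation `M₁ < m ≤ N` of the far modes; the certificate's
`U` majorises the INFINITE sum, hence every truncation, so the conclusion holds for every trigonometric polynomial in
the window and passes to `K(a)` by density, L-C4).  Elementary real algebra; standard axioms only.
-/

-- `Summit.RiemannHypothesis.RiemannHypothesis.…` is the layout-mandated namespace (summit = problem name).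
set_option linter.dupNamespace false

namespace Summit.RiemannHypothesis.RiemannHypothesis.Theorems.WeilFormatC

open Matrix Finset

/-- One far mode: for `e > 0` and any `c, y`, `−c²/e ≤ 2·c·y + e·y²` (complete the square:
`e (y + c/e)² ≥ 0`). -/
theorem two_mul_add_mul_sq_ge {c y e : ℝ} (he : 0 < e) : -(c ^ 2 / e) ≤ 2 * c * y + e * y ^ 2 := by
  have h : 0 ≤ e * (y + c / e) ^ 2 := mul_nonneg he.le (sq_nonneg _)
  have hexp : e * (y + c / e) ^ 2 = 2 * c * y + e * y ^ 2 + c ^ 2 / e := by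
    field_simp
    ring
  linarith [hexp ▸ h]

/-- Summed over a finite set of far modes: `−Σ c_m²/e_m ≤ 2 Σ c_m y_m + Σ e_m y_m²` for `e_m > 0`. -/
theorem neg_sum_sq_div_le {κ : Type*} (s : Finset κ) (c y e : κ → ℝ) (he : ∀ m ∈ s, 0 < e m) :
    -(∑ m ∈ s, c m ^ 2 / e m) ≤ 2 * ∑ m ∈ s, c m * y m + ∑ m ∈ s, e m * y m ^ 2 := by
  have h : ∀ m ∈ s, -(c m ^ 2 / e m) ≤ 2 * (c m * y m) + e m * y m ^ 2 := by
    intro m hm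
    have := two_mul_add_mul_sq_ge (c := c m) (y := y m) (he m hm)
    linarith
  have := Finset.sum_le_sum h
  rw [Finset.sum_add_distrib, ← Finset.mul_sum] at this
  have hneg : -(∑ m ∈ s, c m ^ 2 / e m) = ∑ m ∈ s, -(c m ^ 2 / e m) :=
    (Finset.sum_neg_distrib (s := s) (f := fun m ↦ c m ^ 2 / e m)).symm
  rw [hneg]
  exact this

section Form

variable {ι κ : Type*} [Fintype ι] [Fintype κ]

/-- **Diagonal Schur step, margin form.**  Data: block Gram `G` on the finite mode set `ι`; far modes `κ` with
diagonal lower bound `d` (`far Gram ⪰ diag d`); coupling coefficients `c m = (Bᵀx)_m`; a majorant `U` of the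
weighted coupling Gram, `Σ_m c_m²/(d_m − μ⋆) ≤ xᵀUx`; and the certified matrix inequality
`μ⋆ xᵀx + xᵀUx ≤ xᵀGx`.  Conclusion: `μ⋆ (xᵀx + Σ_m y_m²) ≤ xᵀGx + 2 Σ_m c_m y_m + Σ_m d_m y_m²` for every far
coefficient vector `y` — i.e. `μ⋆ ‖φ‖² ≤ Re Q(φ)` once the far self-energy is bounded below by `Σ d_m y_m²`. -/
theorem schurStepDiag (G U : Matrix ι ι ℝ) (x : ι → ℝ) (c d y : κ → ℝ) {μs : ℝ}
    (hd : ∀ m, μs < d m) (hU : ∑ m, c m ^ 2 / (d m - μs) ≤ x ⬝ᵥ U *ᵥ x)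
    (hS : μs * (x ⬝ᵥ x) + x ⬝ᵥ U *ᵥ x ≤ x ⬝ᵥ G *ᵥ x) :
    μs * (x ⬝ᵥ x + ∑ m, y m ^ 2) ≤ x ⬝ᵥ G *ᵥ x + 2 * ∑ m, c m * y m + ∑ m, d m * y m ^ 2 := by
  have he : ∀ m ∈ (Finset.univ : Finset κ), 0 < d m - μs := fun m _ ↦ sub_pos.mpr (hd m)
  have h := neg_sum_sq_div_le Finset.univ c y (fun m ↦ d m - μs) he
  have hsplit : ∑ m, (d m - μs) * y m ^ 2 = ∑ m, d m * y m ^ 2 - μs * ∑ m, y m ^ 2 := by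
    rw [Finset.mul_sum, ← Finset.sum_sub_distrib]
    refine Finset.sum_congr rfl fun m _ ↦ ?_
    ring
  rw [hsplit] at h
  nlinarith [h, hU, hS]

/-- **Diagonal Schur step, positivity form** (`μ⋆ = 0`): `far ⪰ diag d` with `d > 0`, `Σ c_m²/d_m ≤ xᵀUx`,
`xᵀUx ≤ xᵀGx` ⟹ `0 ≤ xᵀGx + 2 Σ c_m y_m + Σ d_m y_m²`. -/
theorem schurStepDiag_nonneg (G U : Matrix ι ι ℝ) (x : ι → ℝ) (c d y : κ → ℝ)
    (hd : ∀ m, 0 < d m) (hU : ∑ m, c m ^ 2 / d m ≤ x ⬝ᵥ U *ᵥ x)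
    (hS : x ⬝ᵥ U *ᵥ x ≤ x ⬝ᵥ G *ᵥ x) :
    0 ≤ x ⬝ᵥ G *ᵥ x + 2 * ∑ m, c m * y m + ∑ m, d m * y m ^ 2 := by
  have h := schurStepDiag G U x c d y (μs := 0) hd (by simpa using hU) (by simpa using hS)
  simpa using h

/-- The positivity form with the far self-energy as a parameter: if in addition `Σ d_m y_m² ≤ D` (the
far-coercivity lemma L-C3a evaluated at the far part `u = Σ y_m w_m`, `D = Re Q(u)`), then
`0 ≤ xᵀGx + 2 Σ c_m y_m + D` — the full sector form `Re Q(Σ x_n w_n + u)`. -/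
theorem schurStepDiag_nonneg_of_farBound (G U : Matrix ι ι ℝ) (x : ι → ℝ) (c d y : κ → ℝ) {D : ℝ}
    (hd : ∀ m, 0 < d m) (hU : ∑ m, c m ^ 2 / d m ≤ x ⬝ᵥ U *ᵥ x)
    (hS : x ⬝ᵥ U *ᵥ x ≤ x ⬝ᵥ G *ᵥ x) (hD : ∑ m, d m * y m ^ 2 ≤ D) :
    0 ≤ x ⬝ᵥ G *ᵥ x + 2 * ∑ m, c m * y m + D := by
  have h := schurStepDiag_nonneg G U x c d y hd hU hS
  linarith

/-- The positivity form with the kernel step delivered as `(G − U).PosSemidef` — the shape produced by the tree's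
rational PSD checkers (`Literature.Analysis.ValidatedNumerics.PSDCert.posSemidef_map_of_ldltCheck`,
`IntervalGershgorin.posSemidef_of_psdCheck`, or rh-explicit-weil-2's `PsdDyadic.psd_of_checkPsdMid`) on the
rounded-minus-radius matrix. -/
theorem schurStepDiag_posSemidef (G U : Matrix ι ι ℝ) (x : ι → ℝ) (c d y : κ → ℝ)
    (hd : ∀ m, 0 < d m) (hU : ∑ m, c m ^ 2 / d m ≤ x ⬝ᵥ U *ᵥ x)
    (hS : (G - U).PosSemidef) :
    0 ≤ x ⬝ᵥ G *ᵥ x + 2 * ∑ m, c m * y m + ∑ m, d m * y m ^ 2 := by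
  refine schurStepDiag_nonneg G U x c d y hd hU ?_
  have h := hS.dotProduct_mulVec_nonneg x
  simp only [sub_mulVec, dotProduct_sub] at h
  simpa using sub_nonneg.mp (by simpa using h)

omit [Fintype κ] in
/-- How the majorant hypothesis is met from a finite computed part plus a tail bound: if the far modes split as
`s ∪ t` (disjoint), the computed columns give `Σ_{m ∈ s} c_m²/d_m ≤ xᵀU₁x` and the tail model gives
`Σ_{m ∈ t} c_m²/d_m ≤ xᵀU₂x`, then `U = U₁ + U₂` is a majorant over `s ∪ t`. -/
theorem sum_sq_div_le_of_split [DecidableEq κ] (U₁ U₂ : Matrix ι ι ℝ) (x : ι → ℝ) (c d : κ → ℝ)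
    (s t : Finset κ)
    (hst : Disjoint s t) (h₁ : ∑ m ∈ s, c m ^ 2 / d m ≤ x ⬝ᵥ U₁ *ᵥ x)
    (h₂ : ∑ m ∈ t, c m ^ 2 / d m ≤ x ⬝ᵥ U₂ *ᵥ x) :
    ∑ m ∈ s ∪ t, c m ^ 2 / d m ≤ x ⬝ᵥ (U₁ + U₂) *ᵥ x := by
  rw [Finset.sum_union hst, add_mulVec, dotProduct_add]
  exact add_le_add h₁ h₂

end Form

end Summit.RiemannHypothesis.RiemannHypothesis.Theorems.WeilFormatC
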